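import Mathlib
import Literature.AlgebraicGeometry.Resolution.FormalCoordinateChange
import Literature.AlgebraicGeometry.Resolution.FormalInverseFunction
import Summits.ResolutionOfSingularities.ResolutionOfSingularities.Theorems.WeightedInvariantGlobalizeLocalDropCanonize

/-!
# Contact `≥ N` for every `N` ⇒ approximate `d`-th power of a smooth germ (plane germs)

Crux `LocalWeightedDrop` (stmt-ResolutionOfSingularities-8899, route
ResolutionOfSingularities/WeightedInvariant), line `hasse-ridge-face-selection`, registered stub
`stub_contactApprox` of the skeleton `LocalWeightedDrop` (plane case `n = 2` of the local weighted
resolution game).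

For `f ∈ k[[x, y]]` (`x = X 0`, `y = X 1`) of order `d`, "contact `≥ N` in the formal coordinates `Φ`"
means that the `(1, N)`-weighted order of `f ∘ Φ := MvPowerSeries.subst Φ f` is `≥ N · d`, i.e. every
monomial `xⁱ yʲ` of `f ∘ Φ` has `i + N j ≥ N d`.  The statement: if `f` has contact `≥ N` (each `N`
with its own legal `Φ`: zero constant terms, invertible linear part) for EVERY `N`, then for every
`N` it is a unit times a `d`-th power of a smooth germ up to order `N`:
`f = u · L^d + R` with `u(0) ≠ 0`, `L(0) = 0`, some `∂L/∂xᵢ(0) ≠ 0`, `ord R ≥ N`.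

Proof.  Fix `N`, put `N' = max N 2` and take `Φ` with contact `≥ N'`; let `g = f ∘ Φ` and let `ψ` be
the compositional inverse of `Φ` (`FormalCoordChange.exists_comp_inverse`), so `f = g ∘ ψ`
(`subst_subst_of_comp_eq_X`).
* SPLIT `g = y^d · A + R_g` with `A = ∑ₑ g_{e + (0,d)} xᵉ` (the part of `g` divisible by `y^d`,
  divided by `y^d`) and `ord R_g ≥ N'`: a monomial `xⁱ yʲ` of `R_g` has `j < d` and
  `i + N' j ≥ N' d`, so `i ≥ N'(d - j) ≥ N'`.
* `A(0) = g_{(0,d)} ≠ 0`: substitutions with zero constant terms do not decrease the order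
  (`MvPowerSeries.le_order_subst`), so `ord g ≤ ord (g ∘ ψ) = ord f = d`; a monomial `xⁱ yʲ` of `g`
  of degree `i + j = ord g ≤ d` has `i + N' j ≥ N' d ≥ N' (i + j)`, forcing `i = 0` (as `N' ≥ 2`)
  and then `j = d`.
* PULL BACK along `ψ`: `f = (A ∘ ψ) · (ψ 1)^d + R_g ∘ ψ`, with `(A ∘ ψ)(0) = A(0) ≠ 0`
  (`constantCoeff_subst_of_constantCoeff_zero`), `ψ 1` smooth (its linear part is a row of the
  invertible matrix `linMat ψ`, `isUnit_det_linMat_of_comp_eq_X`), and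
  `ord (R_g ∘ ψ) ≥ ord R_g ≥ N' ≥ N`.
-/

set_option linter.dupNamespace false -- mandated namespace of this single-conjunct summit

namespace Summit.ResolutionOfSingularities.ResolutionOfSingularities.Theorems

open Literature.AlgebraicGeometry.Resolution

namespace ContactApprox

variable {k : Type} [Field k]

/-- A substitution by series with zero constant terms does not decrease the order. -/
theorem order_le_order_subst {n : ℕ} {τ : Type*} (a : Fin n → MvPowerSeries τ k)
    (ha : ∀ i, MvPowerSeries.constantCoeff (a i) = 0) (f : MvPowerSeries (Fin n) k) :
    f.order ≤ (MvPowerSeries.subst a f).order := by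
  have h1 : (1 : ℕ∞) ≤ ⨅ i, (a i).order :=
    le_iInf fun i => (MvPowerSeries.one_le_order_iff_constCoeff_eq_zero).mpr (ha i)
  calc f.order = 1 * f.order := (one_mul _).symm
    _ ≤ (⨅ i, (a i).order) * f.order := mul_le_mul' h1 le_rfl
    _ ≤ _ := MvPowerSeries.le_order_subst (MvPowerSeries.hasSubst_of_constantCoeff_zero ha) f

/-- The `(1, N)`-weight of an exponent `(i, j)` is `i + N j`. -/
theorem weight_one_cons (N : ℕ) (e : Fin 2 →₀ ℕ) : Finsupp.weight ![1, N] e = e 0 + N * e 1 := by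
  rw [Finsupp.weight_apply, Finsupp.sum_fintype _ _ (fun i => by simp)]
  simp [Fin.sum_univ_two, mul_comm]

/-- Coefficients of `y^d · A`. -/
theorem coeff_X_pow_mul (d : ℕ) (A : MvPowerSeries (Fin 2) k) (e : Fin 2 →₀ ℕ) :
    MvPowerSeries.coeff e (MvPowerSeries.X 1 ^ d * A) =
      if d ≤ e 1 then MvPowerSeries.coeff (e - Finsupp.single 1 d) A else 0 := by
  rw [MvPowerSeries.X_pow_eq, MvPowerSeries.coeff_monomial_mul, one_mul]
  by_cases h : d ≤ e 1
  · rw [if_pos (Finsupp.single_le_iff.mpr h), if_pos h]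
  · rw [if_neg (fun hle => h (Finsupp.single_le_iff.mp hle)), if_neg h]

end ContactApprox

/-- CONTACT ⇒ APPROXIMATE `d`-TH POWER (plane germs, every field).  If `f` of order `d` admits, for
every `N`, formal coordinates `Φ` in which its `(1,N)`-weighted order is `≥ N·d` ("contact `≥ N`":
every monomial `xⁱyʲ` of `f∘Φ` has `i + N j ≥ N d`), then for every `N` it is a unit times a `d`-th power
of a smooth germ up to order `N`: `f = u·L^d + R`, `ord R ≥ N`.  (Split `f∘Φ = y^d·A + R_g` with
`ord R_g ≥ N` and pull back along the inverse coordinate change.) -/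
theorem stub_contactApprox : ∀ (k : Type) [Field k] (f : MvPowerSeries (Fin 2) k) (d : ℕ), f.order = d →
    (∀ N : ℕ, ∃ Φ : Fin 2 → MvPowerSeries (Fin 2) k, (∀ i, MvPowerSeries.constantCoeff (Φ i) = 0) ∧
      IsUnit (Matrix.det (Matrix.of fun i j => MvPowerSeries.coeff (Finsupp.single j 1) (Φ i))) ∧
      ((N * d : ℕ) : ℕ∞) ≤ MvPowerSeries.weightedOrder ![1, N] (MvPowerSeries.subst Φ f)) →
    ∀ N : ℕ, ∃ (u L R : MvPowerSeries (Fin 2) k), MvPowerSeries.constantCoeff u ≠ 0 ∧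
      MvPowerSeries.constantCoeff L = 0 ∧ (∃ i, MvPowerSeries.coeff (Finsupp.single i 1) L ≠ 0) ∧
      f = u * L ^ d + R ∧ ((N : ℕ) : ℕ∞) ≤ R.order := by
  intro k _ f d hfd hcontact N
  classical
  -- coordinates with contact `≥ N' = max N 2`, and their compositional inverse
  set N' : ℕ := max N 2 with hN'def
  have hN'2 : 2 ≤ N' := le_max_right _ _
  obtain ⟨Φ, hΦ0, hΦdet, hw⟩ := hcontact N'
  obtain ⟨ψ, hψ0, hψΦ, -⟩ := FormalCoordChange.exists_comp_inverse hΦ0 hΦdet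
  have hψs : MvPowerSeries.HasSubst ψ := MvPowerSeries.hasSubst_of_constantCoeff_zero hψ0
  set g : MvPowerSeries (Fin 2) k := MvPowerSeries.subst Φ f with hgdef
  have hfg : f = MvPowerSeries.subst ψ g := (subst_subst_of_comp_eq_X hΦ0 hψ0 hψΦ f).symm
  -- contact: a monomial of `g` has `(1, N')`-weight `≥ N' d`
  have hwt : ∀ e : Fin 2 →₀ ℕ, MvPowerSeries.coeff e g ≠ 0 → N' * d ≤ e 0 + N' * e 1 := by
    intro e he
    by_contra hlt
    push Not at hlt
    refine he (MvPowerSeries.coeff_eq_zero_of_lt_weightedOrder _ (lt_of_lt_of_le ?_ hw))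
    rw [ContactApprox.weight_one_cons]
    exact_mod_cast hlt
  -- `ord g ≤ d`
  have hgd : g.order ≤ d :=
    calc g.order ≤ (MvPowerSeries.subst ψ g).order := ContactApprox.order_le_order_subst ψ hψ0 g
      _ = d := by rw [← hfg, hfd]
  -- the `y^d`-coefficient of `g` is non-zero
  have hkey : MvPowerSeries.coeff (Finsupp.single 1 d) g ≠ 0 := by
    have hfin : g.order.toNat = g.order := ENat.coe_toNat (ne_top_of_le_ne_top (ENat.coe_ne_top d) hgd)
    obtain ⟨e, he, hdeg⟩ := MvPowerSeries.exists_coeff_ne_zero_and_order hfin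
    have hdeg' : e 0 + e 1 ≤ d := by
      have h1 : (e.degree : ℕ∞) ≤ d := hdeg ▸ hgd
      rw [Finsupp.degree_eq_sum, Fin.sum_univ_two] at h1
      exact_mod_cast h1
    have h2 := hwt e he
    have h3 : N' * e 0 + N' * e 1 ≤ N' * d := by
      rw [← mul_add]; exact Nat.mul_le_mul_left _ hdeg'
    have h4 : 2 * e 0 ≤ N' * e 0 := Nat.mul_le_mul_right _ hN'2
    have he0 : e 0 = 0 := by omega
    have he1 : e 1 = d := by
      rcases lt_or_ge (e 1) d with hlt | hge
      · have : N' * e 1 < N' * d := Nat.mul_lt_mul_of_pos_left hlt (by omega)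
        omega
      · omega
    have hed : e = Finsupp.single 1 d := by
      ext i
      fin_cases i
      · simpa using he0
      · simpa using he1
    rwa [hed] at he
  -- SPLIT `g = y^d · A + Rg`
  let A : MvPowerSeries (Fin 2) k := fun e => MvPowerSeries.coeff (e + Finsupp.single 1 d) g
  set Rg : MvPowerSeries (Fin 2) k := g - MvPowerSeries.X 1 ^ d * A with hRgdef
  have hA0 : MvPowerSeries.constantCoeff A = MvPowerSeries.coeff (Finsupp.single 1 d) g := by
    rw [← MvPowerSeries.coeff_zero_eq_constantCoeff_apply, MvPowerSeries.coeff_apply]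
    show MvPowerSeries.coeff (0 + Finsupp.single 1 d) g = _
    rw [zero_add]
  have hRgcoeff : ∀ e : Fin 2 →₀ ℕ, MvPowerSeries.coeff e Rg =
      if d ≤ e 1 then 0 else MvPowerSeries.coeff e g := by
    intro e
    rw [hRgdef, map_sub, ContactApprox.coeff_X_pow_mul]
    by_cases h : d ≤ e 1
    · rw [if_pos h, if_pos h, sub_eq_zero]
      show _ = MvPowerSeries.coeff (e - Finsupp.single 1 d + Finsupp.single 1 d) g
      rw [tsub_add_cancel_of_le (Finsupp.single_le_iff.mpr h)]
    · rw [if_neg h, if_neg h, sub_zero]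
  have hRgord : (N' : ℕ∞) ≤ Rg.order := by
    apply MvPowerSeries.nat_le_order
    intro e he
    rw [hRgcoeff]
    split_ifs with h1
    · rfl
    · by_contra hne
      have h2 := hwt e hne
      rw [Finsupp.degree_eq_sum, Fin.sum_univ_two] at he
      have h3 : N' * (e 1 + 1) ≤ N' * d := Nat.mul_le_mul_left _ (by omega)
      rw [mul_add_one] at h3
      omega
  have hgsplit : g = MvPowerSeries.X 1 ^ d * A + Rg := by rw [hRgdef]; ring
  -- PULL BACK along `ψ`
  have hf' : f = MvPowerSeries.subst ψ A * (ψ 1) ^ d + MvPowerSeries.subst ψ Rg := by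
    conv_lhs => rw [hfg, hgsplit]
    rw [MvPowerSeries.subst_add hψs, MvPowerSeries.subst_mul hψs, MvPowerSeries.subst_pow hψs,
      MvPowerSeries.subst_X hψs]
    ring
  refine ⟨MvPowerSeries.subst ψ A, ψ 1, MvPowerSeries.subst ψ Rg, ?_, hψ0 1, ?_, hf', ?_⟩
  · rw [constantCoeff_subst_of_constantCoeff_zero ψ hψ0 A, hA0]
    exact hkey
  · by_contra hall
    push Not at hall
    have hdet := isUnit_det_linMat_of_comp_eq_X hψ0 hψΦ
    rw [Matrix.det_eq_zero_of_row_eq_zero (A := FormalCoordChange.linMat ψ) 1 fun j => hall j] at hdet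
    exact not_isUnit_zero hdet
  · calc ((N : ℕ) : ℕ∞) ≤ N' := by exact_mod_cast le_max_left _ _
      _ ≤ Rg.order := hRgord
      _ ≤ _ := ContactApprox.order_le_order_subst ψ hψ0 Rg

end Summit.ResolutionOfSingularities.ResolutionOfSingularities.Theorems
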